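import Literature.AlgebraicGeometry.CossartPiltant200819.Tower2008
import Literature.FieldTheory.ArtinSchreier.Rescaled
import Mathlib.FieldTheory.SeparablyGenerated
import HarnessLib

/-!
# Cossart–Piltant 2008, Thm 7.2: the tower WITHOUT the Artin–Schreier normal form

Sequel of `Tower2008.lean`, whose one named fact `TowerExists2008 k` (the field/valuation-theoretic
skeleton of the proof of [CossartPiltant2008] Thm 7.2, HAL pp. 20–21) asks, at every immediate
degree-`p` step `(K, V) → (L, W)` of the tower, for the data the hypothesis of Thm 7.2 consumes: for
EVERY local uniformization `R` of `V`, elements `f, g ∈ R ∩ m_V` (`g ≠ 0` if `k` is perfect) with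
`L ≅ K[X]/(X^p − g^{p−1}X + f)` (`AdmitsASGenerator p V R L`; clause **T-d** of the cell's audit).
In print this is one sentence ("it can be assumed that `η^p_{i+1} ∈ R_{1,i}` … with `g := 0`,
`f := −η^p_{i+1} ∈ m_R`", HAL p. 20; "as in the purely inseparable case", p. 21). Here it is
PROVED, and the named fact is weakened accordingly:

* `exists_mem_ne_zero_valuation_lt_one` — a local model `A ⊆ V` (`QF(A) = K`) of a rank-one
  (non-trivial) valuation ring contains some `t ≠ 0` of positive value;
* `admitsASGenerator_of_isGalois` — **Galois case**: `L/K` Galois of degree `p = char k` admits,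
  for every local model `R` of `V`, the generator `θ' := g ϑ` (`ϑ^p − ϑ = a = a₁/b`, Artin–Schreier,
  `Literature.FieldTheory.ArtinSchreier`; `g := t b`, `f := −g^p a = −t^p b^{p−1} a₁ ∈ A ∩ m_V`);
* `admitsASGenerator_of_pthRoot` — **purely inseparable case** (`k` imperfect): `L = K(η)`,
  `η^p = b₀ ∈ K`, `[L:K] = p` admits `θ' := t b η`, `g := 0`, `f := −θ'^p ∈ A ∩ m_V`;
* `GMove3` / `GReach3` — the moves of `Tower2008.Move3` with the constructor `artinSchreier`
  replaced by `galoisP` (a Galois extension of degree `p`, unique and immediate extension of the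
  valuation ring — NO generator clause) and `inseparableP` (a simple purely inseparable extension
  of degree `p`, `k` imperfect, unique and immediate extension); `GMove3.toMove3` PROVED;
* `GaloisTowerExists2008 k` — the weakened NAMED FACT: from the stage `(k(x), V ∩ k(x))` of ANY
  transcendence basis `x = (x₁, x₂, x₃)` of `K/k` which is separating when `k` is perfect, the
  stage `(K, V)` is reached by finitely many `GMove3`-moves;
* `towerExists2008_of_galoisTower : GaloisTowerExists2008 k → TowerExists2008 k` — PROVED; the
  separating transcendence basis for perfect `k` ("by [37] theorem 26.3", HAL p. 20, i.e.
  Matsumura, *Commutative ring theory*, Thms 26.2–26.3) is Mathlib's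
  `exists_isTranscendenceBasis_and_isSeparable_of_perfectField` (clause **T-a**, first half);
* `reductionToArtinSchreier_of_galoisTower`, `lu3DiffFinite_of_galoisTower` — Thm 7.2 and the
  local uniformization theorem from the leaves, with the weaker tower fact.

What remains inside `GaloisTowerExists2008` (not in doubt, standard): Galois closure and Hilbert
ramification theory of `L/K₀` with the central series of the `p`-group `G_r⁰` (T-b), the
fundamental (in)equality `[L:K] = s·e·f·p^d` sorting each prime-degree step into Prop 8.3 or the
immediate case (T-c), inheritance of finite generation / `trdeg 3` / rank one / residual
algebraicity along the tower (T-e), `s = 1` above the splitting field (T-f), the degree-`p`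
filtration of the purely inseparable part `K₁ ⊆ K` (T-a, second half), universe bookkeeping (T-g).

## References

* V. Cossart, O. Piltant, *Resolution of singularities of threefolds in positive characteristic.
  I*, J. Algebra 320 (2008) 1051–1082 = HAL hal-00139124 (2007), Def 7.1, Thm 7.2 and its proof,
  pp. 19–21 of the HAL version. [CossartPiltant2008]
* S. Lang, *Algebra*, GTM 211, VI §6 Thm. 6.4 (Artin–Schreier). [Lang2002]
* H. Matsumura, *Commutative ring theory*, Thms 26.2, 26.3 (separating transcendence bases).
-/

namespace Literature.AlgebraicGeometry.CossartPiltant200819.CP2008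

open Literature.AlgebraicGeometry.Resolution Polynomial
open Literature.FieldTheory.ArtinSchreier (exists_rescaled_artinSchreier_generator
  rescaled_pthRoot_generator)
open IntermediateField

universe u

section Generators

variable {k K : Type u} [Field k] [Field K] [Algebra k K]

/-- **A local model of a non-trivial valuation ring meets the maximal ideal**: if `A ⊆ V` has
fraction field `K` and `V` has rank one (so its valuation is non-trivial), some `t ∈ A`, `t ≠ 0`,
has `V(t) > 0` (write an element of value `≠ 0, 1` as `a/b` with `a, b ∈ A`; one of `a`, `b`
works). [folklore] -/
theorem exists_mem_ne_zero_valuation_lt_one (O : ValuationSubring K)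
    (h1 : Nonempty O.valuation.RankOne) (A : Subalgebra k K) [IsFractionRing A K]
    (hA : A.toSubring ≤ O.toSubring) : ∃ t : K, t ∈ A ∧ t ≠ 0 ∧ O.valuation t < 1 := by
  obtain ⟨hr⟩ := h1
  obtain ⟨z, hz0, hz1⟩ := hr.toIsNontrivial.exists_val_nontrivial
  obtain ⟨a, b, hb, hab⟩ := IsFractionRing.div_surjective (A := A) z
  have hb0 : (b : K) ≠ 0 := fun h => nonZeroDivisors.ne_zero hb (Subtype.ext h)
  have hva : O.valuation (a : K) ≤ 1 := (O.valuation_le_one_iff _).mpr (hA a.2)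
  have hvb : O.valuation (b : K) ≤ 1 := (O.valuation_le_one_iff _).mpr (hA b.2)
  have hab' : (a : K) / b = z := hab
  have hz' : (a : K) = z * b := by rw [← hab', div_mul_cancel₀ _ hb0]
  have hva' : O.valuation (a : K) = O.valuation z * O.valuation (b : K) := by rw [hz', map_mul]
  rcases lt_or_gt_of_ne hz1 with hlt | hgt
  · refine ⟨a, a.2, ?_, ?_⟩
    · intro ha0
      apply hz0
      rw [← hab', ha0, zero_div, map_zero]
    · calc O.valuation (a : K) = O.valuation z * O.valuation (b : K) := hva'
        _ ≤ O.valuation z * 1 := mul_le_mul' le_rfl hvb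
        _ = O.valuation z := mul_one _
        _ < 1 := hlt
  · refine ⟨b, b.2, hb0, ?_⟩
    rcases hvb.lt_or_eq with h | h
    · exact h
    · exfalso
      rw [hva', h, mul_one] at hva
      exact (not_le.mpr hgt) hva

/-- `A ⊆ R = A_𝔭` for a local model presented as fractions `a/s`, `s ∈ A` of value `1` (`s := 1`).
[folklore] -/
theorem mem_of_mem_model {O : ValuationSubring K} {R A : Subalgebra k K}
    (hRset : (R : Set K) = {x | ∃ a ∈ A, ∃ s ∈ A, O.valuation s = 1 ∧ x = a * s⁻¹}) {x : K}
    (hx : x ∈ A) : x ∈ R := by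
  have h : x ∈ (R : Set K) := by
    rw [hRset]
    exact ⟨x, hx, 1, one_mem A, map_one _, by rw [inv_one, mul_one]⟩
  exact h

/-- `V(t · y) < 1` for `t, y ∈ V` with `V(t) < 1`. [folklore] -/
theorem valuation_mul_lt_one {O : ValuationSubring K} {t y : K} (ht : O.valuation t < 1)
    (hy : y ∈ O) : O.valuation (t * y) < 1 :=
  calc O.valuation (t * y) = O.valuation t * O.valuation y := map_mul _ _ _
    _ ≤ O.valuation t * 1 := mul_le_mul' le_rfl ((O.valuation_le_one_iff _).mpr hy)
    _ = O.valuation t := mul_one _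
    _ < 1 := ht

/-- The rescaling identity: `(t b)^p · (a₁ / b) = t · (t^{p−1} b^{p−1} a₁)` (`b ≠ 0`, `p ≥ 1`).
[folklore] -/
theorem rescale_identity {p : ℕ} (hp : p ≠ 0) (t a₁ b : K) (hb : b ≠ 0) :
    (t * b) ^ p * (a₁ / b) = t * (t ^ (p - 1) * b ^ (p - 1) * a₁) := by
  have ht : t ^ p = t * t ^ (p - 1) := (mul_pow_sub_one hp t).symm
  have hb' : b ^ p = b ^ (p - 1) * b := (pow_sub_one_mul hp b).symm
  rw [mul_pow, ht, hb']
  field_simp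

/-- **Clause T-d, Galois case** (HAL p. 21 l. 12–15, "as in the purely inseparable case … by
assumption in the statement of the theorem (immediate case)"): a Galois extension `L/K` of degree
`p = char k` admits an Artin–Schreier generator adapted to EVERY local model `R` of a rank-one
`k`-valuation ring `V` of `K` (`AdmitsASGenerator`). Proof: Artin–Schreier gives `L = K(ϑ)`,
`ϑ^p − ϑ = a ∈ K`; write `a = a₁/b` over the affine model `A` of `R`, pick `0 ≠ t ∈ A ∩ m_V`
(`exists_mem_ne_zero_valuation_lt_one`), put `g := t b`, `θ' := g ϑ`: then
`θ'^p − g^{p−1}θ' + f = 0` with `f := −g^p a = −t·(t^{p−1} b^{p−1} a₁) ∈ A ∩ m_V`, and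
`h = X^p − g^{p−1}X + f` is the minimal polynomial of the primitive element `θ'`
(`Literature.FieldTheory.ArtinSchreier.exists_rescaled_artinSchreier_generator`). PROVED.
[cite: CossartPiltant2008, Thm 7.2 proof (HAL p. 21 l. 12–15)] -/
theorem admitsASGenerator_of_isGalois {p : ℕ} (hp : p.Prime) [CharP k p]
    (O : ValuationSubring K) (h1 : Nonempty O.valuation.RankOne) {R : Subalgebra k K}
    (hR : IsLocalModelOf k K O R) (L : Type u) [Field L] [Algebra K L] [FiniteDimensional K L]
    [IsGalois K L] (hdeg : Module.finrank K L = p) : AdmitsASGenerator p O R L := by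
  haveI : Fact p.Prime := ⟨hp⟩
  haveI : CharP K p := charP_of_injective_algebraMap (algebraMap k K).injective p
  obtain ⟨A, -, hfrac, hAO, hRset⟩ := hR
  obtain ⟨t, htA, ht0, hvt⟩ := exists_mem_ne_zero_valuation_lt_one O h1 A hAO
  obtain ⟨ϑ, a, hϑ, -, hresc⟩ := exists_rescaled_artinSchreier_generator (K := K) (L := L) p hdeg
  obtain ⟨a₁, b, hb, hab⟩ := IsFractionRing.div_surjective (A := A) a
  have hb0 : (b : K) ≠ 0 := fun h => nonZeroDivisors.ne_zero hb (Subtype.ext h)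
  have hg0 : t * b ≠ 0 := mul_ne_zero ht0 hb0
  obtain ⟨-, hirr, hL⟩ := hresc (t * b) hg0
  -- the constant coefficient `f = -(g^p a) = -(t · f₀)`, `f₀ ∈ A`
  have hf : -((t * (b : K)) ^ p * a) = -(t * (t ^ (p - 1) * (b : K) ^ (p - 1) * a₁)) := by
    rw [← hab]
    exact congrArg Neg.neg (rescale_identity hp.ne_zero t a₁ b hb0)
  have hf₀A : t ^ (p - 1) * (b : K) ^ (p - 1) * a₁ ∈ A :=
    mul_mem (mul_mem (pow_mem htA _) (pow_mem b.2 _)) a₁.2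
  refine ⟨-((t * (b : K)) ^ p * a), t * b, ?_, mem_of_mem_model hRset (mul_mem htA b.2), ?_,
    valuation_mul_lt_one hvt (hAO b.2), fun _ => hg0, hirr, hL⟩
  · rw [hf]
    exact mem_of_mem_model hRset (neg_mem (mul_mem htA hf₀A))
  · rw [hf, Valuation.map_neg]
    exact valuation_mul_lt_one hvt (hAO hf₀A)

/-- **Clause T-d, purely inseparable case** (HAL p. 20 l. 24–28: "there exists
`η_{i+1} ∈ m_V ∩ K_{1,i+1}` with `K_{1,i+1} = K_{1,i}(η_{i+1})` … it can be assumed that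
`η^p_{i+1} ∈ R_{1,i}`. Then … with `R := R_{1,i}` and `g := 0`, `f := −η^p_{i+1} ∈ m_R`"): a simple
purely inseparable extension `L = K(η)`, `η^p = b₀ ∈ K`, of degree `p` admits such a generator
for EVERY local model `R` of a rank-one `V` when `k` is imperfect (`g = 0` is then allowed):
`θ' := t b η` with `b₀ = a₁/b` over the affine model and `0 ≠ t ∈ A ∩ m_V`, `f := −θ'^p =
−t·(t^{p−1} b^{p−1} a₁) ∈ A ∩ m_V`, `h = X^p + f` the minimal polynomial of `θ'`
(`Literature.FieldTheory.ArtinSchreier.rescaled_pthRoot_generator`). The printed route through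
Cor 4.6 is not needed. PROVED. [cite: CossartPiltant2008, Thm 7.2 proof (HAL p. 20 l. 24–28)] -/
theorem admitsASGenerator_of_pthRoot {p : ℕ} (hp : p.Prime) (hkp : ¬ PerfectField k)
    (O : ValuationSubring K) (h1 : Nonempty O.valuation.RankOne) {R : Subalgebra k K}
    (hR : IsLocalModelOf k K O R) (L : Type u) [Field L] [Algebra K L] [FiniteDimensional K L]
    (hdeg : Module.finrank K L = p) {η : L} {b₀ : K} (hη : η ^ p = algebraMap K L b₀)
    (hηtop : K⟮η⟯ = ⊤) : AdmitsASGenerator p O R L := by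
  haveI : Fact p.Prime := ⟨hp⟩
  obtain ⟨A, -, hfrac, hAO, hRset⟩ := hR
  obtain ⟨t, htA, ht0, hvt⟩ := exists_mem_ne_zero_valuation_lt_one O h1 A hAO
  obtain ⟨a₁, b, hb, hab⟩ := IsFractionRing.div_surjective (A := A) b₀
  have hb0 : (b : K) ≠ 0 := fun h => nonZeroDivisors.ne_zero hb (Subtype.ext h)
  have hc0 : t * b ≠ 0 := mul_ne_zero ht0 hb0
  obtain ⟨-, -, hirr, hL⟩ := rescaled_pthRoot_generator hdeg hη hηtop hc0
  have hf : -((t * (b : K)) ^ p * b₀) = -(t * (t ^ (p - 1) * (b : K) ^ (p - 1) * a₁)) := by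
    rw [← hab]
    exact congrArg Neg.neg (rescale_identity hp.ne_zero t a₁ b hb0)
  have hf₀A : t ^ (p - 1) * (b : K) ^ (p - 1) * a₁ ∈ A :=
    mul_mem (mul_mem (pow_mem htA _) (pow_mem b.2 _)) a₁.2
  refine ⟨-((t * (b : K)) ^ p * b₀), 0, ?_, zero_mem R, ?_, by rw [map_zero]; exact zero_lt_one,
    fun hk => absurd hk hkp, hirr, hL⟩
  · rw [hf]
    exact mem_of_mem_model hRset (neg_mem (mul_mem htA hf₀A))
  · rw [hf, Valuation.map_neg]
    exact valuation_mul_lt_one hvt (hAO hf₀A)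

end Generators

/-! ### The moves without normal form -/

/-- **One step of the proof of Thm 7.2, normal-form free**: the constructors of `Tower2008.Move3`
with `artinSchreier` replaced by
* `galoisP` — an immediate Galois step of degree `p = char k` (HAL p. 21 l. 11–15: the steps of
  the tower `K₀ʳ ⊆ … ⊆ Kʳ` cut out by the central series of the `p`-group `G_r⁰`): `L/K` Galois
  of degree `p`, `W` the unique extension of the rank-one, residually algebraic `V`, `V ⊂ W`
  immediate;
* `inseparableP` — an immediate purely inseparable step of degree `p` (HAL p. 20 l. 18–28: the
  tower `K₁ ⊂ K₁,₁ ⊂ … ⊂ K`, absent when `k` is perfect): `k` imperfect, `L = K(η)` with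
  `η^p ∈ K`, `[L:K] = p`, `W` the unique extension of `V`, immediate.
[cite: CossartPiltant2008, Thm 7.2 proof (HAL pp. 20–21)] -/
inductive GMove3 (k : Type u) [Field k] : VState k → VState k → Prop
  | inertiaUp {K : Type u} [Field K] [Algebra k K] (hfg : (⊤ : IntermediateField k K).FG)
      (h3 : Algebra.trdeg k K = 3) {L : Type u} [Field L] [Algebra K L] [Algebra k L]
      [IsScalarTower k K L] (hfin : FiniteDimensional K L) (hgal : IsGalois K L)
      (W : ValuationSubring L) (hkW : ∀ c : k, algebraMap k L c ∈ W) (K' : IntermediateField K L)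
      (hK' : LeInertiaField K W K') :
      GMove3 k ⟨K, W.comap (algebraMap K L), forall_algebraMap_mem_comap hkW⟩
        ⟨K', W.comap (algebraMap K' L), forall_algebraMap_mem_comap_intermediateField hkW K'⟩
  | primeUp {K : Type u} [Field K] [Algebra k K] (hfg : (⊤ : IntermediateField k K).FG)
      (h3 : Algebra.trdeg k K = 3) {L : Type u} [Field L] [Algebra K L] [Algebra k L]
      [IsScalarTower k K L] (hprime : (Module.finrank K L).Prime) (W : ValuationSubring L)
      (hkW : ∀ c : k, algebraMap k L c ∈ W) (h1 : Nonempty W.valuation.RankOne)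
      (hef : inertiaDegree K W = Module.finrank K L ∨ ramificationIndex K W = Module.finrank K L) :
      GMove3 k ⟨K, W.comap (algebraMap K L), forall_algebraMap_mem_comap hkW⟩ ⟨L, W, hkW⟩
  | galoisP {K : Type u} [Field K] [Algebra k K] (hfg : (⊤ : IntermediateField k K).FG)
      (h3 : Algebra.trdeg k K = 3) (O : ValuationSubring K) (hk : ∀ c : k, algebraMap k K c ∈ O)
      (h1 : Nonempty O.valuation.RankOne) (halg : residueTrdeg k O hk = 0) (p : ℕ) (hp : p.Prime)
      (hchar : CharP k p) {L : Type u} [Field L] [Algebra K L] [Algebra k L] [IsScalarTower k K L]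
      (hfin : FiniteDimensional K L) (hgal : IsGalois K L) (hdeg : Module.finrank K L = p)
      (W : ValuationSubring L) (hkW : ∀ c : k, algebraMap k L c ∈ W)
      (hWO : W.comap (algebraMap K L) = O)
      (huniq : ∀ W' : ValuationSubring L, W'.comap (algebraMap K L) = O → W' = W)
      (himm : IsImmediate K W) :
      GMove3 k ⟨K, O, hk⟩ ⟨L, W, hkW⟩
  | inseparableP {K : Type u} [Field K] [Algebra k K] (hfg : (⊤ : IntermediateField k K).FG)
      (h3 : Algebra.trdeg k K = 3) (O : ValuationSubring K) (hk : ∀ c : k, algebraMap k K c ∈ O)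
      (h1 : Nonempty O.valuation.RankOne) (halg : residueTrdeg k O hk = 0) (p : ℕ) (hp : p.Prime)
      (hchar : CharP k p) (hkp : ¬ PerfectField k) {L : Type u} [Field L] [Algebra K L]
      [Algebra k L] [IsScalarTower k K L] (hfin : FiniteDimensional K L)
      (hdeg : Module.finrank K L = p) (η : L) (b₀ : K) (hη : η ^ p = algebraMap K L b₀)
      (hηtop : K⟮η⟯ = ⊤) (W : ValuationSubring L) (hkW : ∀ c : k, algebraMap k L c ∈ W)
      (hWO : W.comap (algebraMap K L) = O)
      (huniq : ∀ W' : ValuationSubring L, W'.comap (algebraMap K L) = O → W' = W)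
      (himm : IsImmediate K W) :
      GMove3 k ⟨K, O, hk⟩ ⟨L, W, hkW⟩
  | ramificationDown {K : Type u} [Field K] [Algebra k K] (hfg : (⊤ : IntermediateField k K).FG)
      (h3 : Algebra.trdeg k K = 3) {L : Type u} [Field L] [Algebra K L] [Algebra k L]
      [IsScalarTower k K L] (hfin : FiniteDimensional K L) (hgal : IsGalois K L)
      (W : ValuationSubring L) (hkW : ∀ c : k, algebraMap k L c ∈ W)
      (h1 : Nonempty W.valuation.RankOne) (halg : residueTrdeg k W hkW = 0)
      (K' : IntermediateField K L) (hK' : LeRamificationField K W K') :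
      GMove3 k ⟨K', W.comap (algebraMap K' L), forall_algebraMap_mem_comap_intermediateField hkW K'⟩
        ⟨K, W.comap (algebraMap K L), forall_algebraMap_mem_comap hkW⟩
  | iso {K₁ K₂ : Type u} [Field K₁] [Algebra k K₁] [Field K₂] [Algebra k K₂] (e : K₁ ≃ₐ[k] K₂)
      (O : ValuationSubring K₂) (hk : ∀ c : k, algebraMap k K₂ c ∈ O) :
      GMove3 k ⟨K₁, O.comap (e : K₁ →+* K₂), forall_algebraMap_mem_comap_algEquiv e hk⟩ ⟨K₂, O, hk⟩

/-- **Finitely many normal-form-free steps.** [folklore] -/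
def GReach3 (k : Type u) [Field k] : VState k → VState k → Prop :=
  Relation.ReflTransGen (GMove3 k)

/-- **Every normal-form-free move is a move**: the generator clause of `Move3.artinSchreier` is
supplied by `admitsASGenerator_of_isGalois` / `admitsASGenerator_of_pthRoot` (clause T-d). PROVED.
[folklore] -/
theorem GMove3.toMove3 {k : Type u} [Field k] {s t : VState k} (h : GMove3 k s t) :
    Move3 k s t := by
  cases h with
  | inertiaUp hfg h3 hfin hgal W hkW K' hK' => exact Move3.inertiaUp hfg h3 hfin hgal W hkW K' hK'
  | primeUp hfg h3 hprime W hkW h1 hef => exact Move3.primeUp hfg h3 hprime W hkW h1 hef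
  | galoisP hfg h3 O hk h1 halg p hp hchar hfin hgal hdeg W hkW hWO huniq himm =>
    exact Move3.artinSchreier hfg h3 O hk h1 halg p hp hchar W hkW hWO huniq himm
      (fun R hR => admitsASGenerator_of_isGalois hp O h1 hR.1 _ hdeg)
  | inseparableP hfg h3 O hk h1 halg p hp hchar hkp hfin hdeg η b₀ hη hηtop W hkW hWO huniq himm =>
    exact Move3.artinSchreier hfg h3 O hk h1 halg p hp hchar W hkW hWO huniq himm
      (fun R hR => admitsASGenerator_of_pthRoot hp hkp O h1 hR.1 _ hdeg hη hηtop)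
  | ramificationDown hfg h3 hfin hgal W hkW h1 halg K' hK' =>
    exact Move3.ramificationDown hfg h3 hfin hgal W hkW h1 halg K' hK'
  | iso e O hk => exact Move3.iso e O hk

/-- **A normal-form-free chain is a chain of moves.** [folklore] -/
theorem GReach3.toReach3 {k : Type u} [Field k] {s t : VState k} (h : GReach3 k s t) :
    Reach3 k s t := by
  induction h with
  | refl => exact Relation.ReflTransGen.refl
  | tail _ hm ih => exact Relation.ReflTransGen.tail ih hm.toMove3

/-! ### The base stage and the weakened tower fact -/

/-- **The base stage `(K₀, V₀)`** (HAL p. 20 l. 4–6: "`K₀ := k(x₁, x₂, x₃)` … `V₀ := V ∩ K₀`") of a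
family `x` in `K`. [cite: CossartPiltant2008, Thm 7.2 proof (HAL p. 20 l. 4–6)] -/
def baseStage {k K : Type u} [Field k] [Field K] [Algebra k K] (x : Fin 3 → K)
    (O : ValuationSubring K) (hk : ∀ c : k, algebraMap k K c ∈ O) : VState k :=
  ⟨IntermediateField.adjoin k (Set.range x),
    O.comap (algebraMap (IntermediateField.adjoin k (Set.range x)) K),
    forall_algebraMap_mem_comap hk⟩

/-- **The tower of the proof of Thm 7.2 exists, normal-form free** (Cossart–Piltant 2008, HAL
pp. 20–21) — NAMED FACT, `TowerExists2008` with clause T-d and the choice of the transcendence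
basis removed: for `k` of characteristic `p > 0`, `K/k` finitely generated of transcendence degree
three, `V` a `k`-valuation ring of `K` of rank one with `κ(V)/k` algebraic, and ANY transcendence
basis `x = (x₁, x₂, x₃)` of `K/k` such that `K/k(x)` is separable if `k` is perfect, the stage
`(K, V)` is reached from `(k(x), V ∩ k(x))` by finitely many moves `GMove3`: the climb into the
inertia field (Cor 6.3), prime-degree steps with `e = l` or `f = l` (Prop 8.3), immediate Galois
steps of degree `p` and — for imperfect `k` — immediate purely inseparable steps of degree `p`
(the cases of the hypothesis of Thm 7.2), the descent below the ramification field (Prop 9.5),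
and renamings along `k`-isomorphisms of valued fields.
[cite: CossartPiltant2008, Thm 7.2 proof (HAL pp. 20–21)] -/
def GaloisTowerExists2008 (k : Type u) [Field k] : Prop :=
  ∀ (p : ℕ), p.Prime → CharP k p →
  ∀ (K : Type u) [Field K] [Algebra k K], (⊤ : IntermediateField k K).FG → Algebra.trdeg k K = 3 →
  ∀ (O : ValuationSubring K) (hk : ∀ c : k, algebraMap k K c ∈ O), Nonempty O.valuation.RankOne →
    residueTrdeg k O hk = 0 →
  ∀ (x : Fin 3 → K), IsTranscendenceBasis k x →
    (PerfectField k → Algebra.IsSeparable (IntermediateField.adjoin k (Set.range x)) K) →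
    GReach3 k (baseStage x O hk) ⟨K, O, hk⟩

/-- **A transcendence basis indexed by `Fin 3`** with the same range as a given one, when
`trdeg_k K = 3`. [folklore] -/
theorem exists_fin_isTranscendenceBasis {k K : Type u} [Field k] [Field K] [Algebra k K]
    (h3 : Algebra.trdeg k K = 3) {ι : Type u} {v : ι → K} (hv : IsTranscendenceBasis k v) :
    ∃ x : Fin 3 → K, IsTranscendenceBasis k x ∧ Set.range x = Set.range v := by
  have hcard : Cardinal.mk ι = ((3 : ℕ) : Cardinal) := by
    rw [hv.cardinalMk_eq_trdeg, h3]
    norm_cast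
  obtain ⟨e⟩ := Cardinal.mk_eq_nat_iff.mp hcard
  exact ⟨v ∘ e.symm, (isTranscendenceBasis_equiv e.symm).mpr hv, e.symm.surjective.range_comp v⟩

/-- **`TowerExists2008` from the normal-form-free tower** — PROVED: choose a transcendence basis
`x` of `K/k`, separating if `k` is perfect (Matsumura Thms 26.2–26.3 = Mathlib's
`exists_isTranscendenceBasis_and_isSeparable_of_perfectField`; clause T-a), take the base stage
`(k(x), V ∩ k(x))` (purely transcendental: generated by the algebraically independent `x`), and
turn the `GMove3`-chain into a `Move3`-chain by `GMove3.toMove3` (clause T-d).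
[cite: CossartPiltant2008, Thm 7.2 proof (HAL p. 20 l. 4–18)] -/
theorem towerExists2008_of_galoisTower {k : Type u} [Field k] (hG : GaloisTowerExists2008 k) :
    TowerExists2008 k := by
  intro p hp hchar K _ _ hfg h3 O hk h1 halg
  haveI : Algebra.EssFiniteType k K := IntermediateField.fg_top_iff.mp hfg
  -- a transcendence basis `x : Fin 3 → K`, separating if `k` is perfect
  obtain ⟨x, hx, hsep⟩ : ∃ x : Fin 3 → K, IsTranscendenceBasis k x ∧
      (PerfectField k → Algebra.IsSeparable (IntermediateField.adjoin k (Set.range x)) K) := by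
    by_cases hperf : PerfectField k
    · obtain ⟨s, hs, hsep⟩ := exists_isTranscendenceBasis_and_isSeparable_of_perfectField k K
      obtain ⟨x, hx, hrange⟩ := exists_fin_isTranscendenceBasis h3 hs
      refine ⟨x, hx, fun _ => ?_⟩
      have hr : Set.range x = (s : Set K) := by
        rw [hrange, Subtype.range_coe_subtype, Finset.setOf_mem]
      rwa [hr]
    · obtain ⟨s, hs⟩ := exists_isTranscendenceBasis k K
      obtain ⟨x, hx, -⟩ := exists_fin_isTranscendenceBasis h3 hs
      exact ⟨x, hx, fun h => absurd h hperf⟩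
  -- the base stage is purely transcendental, generated by `x`
  set K₀ : IntermediateField k K := IntermediateField.adjoin k (Set.range x) with hK₀
  let x' : Fin 3 → K₀ := fun i => ⟨x i, IntermediateField.subset_adjoin k _ ⟨i, rfl⟩⟩
  have hx'ind : AlgebraicIndependent k x' := AlgebraicIndependent.of_comp K₀.val hx.1
  have hx'top : IntermediateField.adjoin k (Set.range x') = ⊤ := by
    apply IntermediateField.lift_injective
    rw [IntermediateField.lift_adjoin, IntermediateField.lift_top, ← Set.range_comp]
    rfl
  exact ⟨baseStage x O hk, ⟨x', hx'ind, hx'top⟩,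
    (hG p hp hchar K hfg h3 O hk h1 halg x hx hsep).toReach3⟩

/-! ### Theorem 7.2 and Theorem 2.1 from the leaves, with the weaker tower fact -/

/-- **Cossart–Piltant 2008, Theorem 7.2 (`ReductionToArtinSchreier`) from its leaves, with the
normal-form-free tower** — PROVED: Cor 6.3, Prop 8.3, Prop 9.5 and `GaloisTowerExists2008` give
Thm 7.2 (through `towerExists2008_of_galoisTower` and `reductionToArtinSchreier_of_tower`).
[cite: CossartPiltant2008, Thm 7.2 (HAL pp. 19–21)] -/
theorem reductionToArtinSchreier_of_galoisTower (h63 : ClimbToInertiaField.{u})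
    (h83 : PrimeDegreeAscent.{u}) (h95 : DescentBelowRamificationField.{u})
    (hG : ∀ (k : Type u) [Field k], GaloisTowerExists2008 k) : ReductionToArtinSchreier.{u} :=
  reductionToArtinSchreier_of_tower h63 h83 h95 fun k _ => towerExists2008_of_galoisTower (hG k)

/-- **The local uniformization theorem of Cossart–Piltant 2008 (`LU3DiffFinite`) from its
leaves, with the normal-form-free tower** — PROVED: Prop 5.1, Cor 6.3, Prop 8.3, Prop 9.5,
`GaloisTowerExists2008` and [CP2]'s Main theorem.
[cite: CossartPiltant2008, Thm 2.1 proof (HAL pp. 3–4, 16, 19–21)] -/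
theorem lu3DiffFinite_of_galoisTower (p51 : RankReduction.{u}) (h63 : ClimbToInertiaField.{u})
    (h83 : PrimeDegreeAscent.{u}) (h95 : DescentBelowRamificationField.{u})
    (hG : ∀ (k : Type u) [Field k], GaloisTowerExists2008 k) (cp2 : CossartPiltant2009Main.{u}) :
    LU3DiffFinite.{u} :=
  lu3DiffFinite_of_tower p51 h63 h83 h95 (fun k _ => towerExists2008_of_galoisTower (hG k)) cp2

end Literature.AlgebraicGeometry.CossartPiltant200819.CP2008
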